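import Literature.MathematicalPhysics.QuantumLattice.HubbardEnergyDensityCertificateLimit
import Summits.Ventures.CertifiedManyBodySolver.Statement
import HarnessLib

/-!
# Sketch — certificate-frustration ladder (CFL), crux idea for `LowerEdge_ge_m4o5` (stmt-Ventures-21721)

First checkable statements of the line (planner sketch, not a proof of any item):

* `torus_increment` — the per-torus inequality. On the `L×L` torus with `N` electrons let `E` be the
  sector ground energy, `c` the constant of the 2-D certificate of record and `μ` its filling multiplier,
  `pW` the ground-state expectation of the y-translate sum of the multiplicity-weighted wrapped strip
  operator `Q_W` (the certificate's SOS pieces confined to `W` consecutive rows), `pR` the expectation of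
  the remaining SOS pieces, and `Φ` a certified frustration density of `Q_W` on `W`-leg rings of every
  large length (a 1-D certificate, KSDN class). The certificate identity gives
  `E − c L² − μ (N − n L²) = pW + pR` (all equality / stationarity / Ward rows vanish on the sector ground
  state), sub-sum positivity gives `0 ≤ pR`, and the strip cut gives `L² Φ ≤ pW` (`L` translates in `y`,
  each `≥ L Φ`). Conclusion: `(c + Φ) + μ (N/L² − n) ≤ E/L²` — the OLD finite-`L` certificate inequality
  with `c` replaced by `c + Φ`, one-for-one, no re-solve of the 2-D program.
* `m3LowerRow_of_strip_increment` — transport to the route's row constant through the tree's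
  `energyDensity2D_ge_of_eventually_ge_torus` and `energyDensityTT'_zero`.

A certified bound is a number with a certificate; nothing here predicts superconductivity.
-/

namespace Summit.Ventures.CertifiedManyBodySolver.Cruxes.LowerEdge_ge_m4o5.CertificateFrustrationLadder

open Filter Topology
open Literature.MathematicalPhysics.QuantumLattice
open Literature.MathematicalPhysics.QuantumLattice.ThermodynamicLimit
open Summit.Ventures.CertifiedManyBodySolver

/-- **Strip-frustration increment, finite-torus form.** See the module docstring for the reading of
the real parameters. Pure bookkeeping: identity + sub-sum positivity + strip cut ⇒ the finite-`L`
certificate inequality at the lifted constant `c + Φ`. -/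
theorem torus_increment {E c μ N n pW pR Φ : ℝ} {L : ℕ} (hL : 0 < L)
    (hId : E - c * (L : ℝ) ^ 2 - μ * (N - n * (L : ℝ) ^ 2) = pW + pR)
    (hR : 0 ≤ pR) (hW : (L : ℝ) ^ 2 * Φ ≤ pW) :
    (c + Φ) + μ * (N / (L : ℝ) ^ 2 - n) ≤ E / (L : ℝ) ^ 2 := by
  have hL2 : (0 : ℝ) < (L : ℝ) ^ 2 := by positivity
  have hne : ((L : ℝ) ^ 2) ≠ 0 := ne_of_gt hL2
  have h1 : (c + Φ) * (L : ℝ) ^ 2 = c * (L : ℝ) ^ 2 + (L : ℝ) ^ 2 * Φ := by ring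
  have hkey : (c + Φ) * (L : ℝ) ^ 2 + μ * (N - n * (L : ℝ) ^ 2) ≤ E := by
    linarith [hId, hR, hW, h1]
  rw [le_div_iff₀ hL2]
  have hdiv : N / (L : ℝ) ^ 2 * (L : ℝ) ^ 2 = N := div_mul_cancel₀ N hne
  have hexp : ((c + Φ) + μ * (N / (L : ℝ) ^ 2 - n)) * (L : ℝ) ^ 2
      = (c + Φ) * (L : ℝ) ^ 2 + μ * (N - n * (L : ℝ) ^ 2) := by
    calc ((c + Φ) + μ * (N / (L : ℝ) ^ 2 - n)) * (L : ℝ) ^ 2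
        = (c + Φ) * (L : ℝ) ^ 2 + μ * (N / (L : ℝ) ^ 2 * (L : ℝ) ^ 2 - n * (L : ℝ) ^ 2) := by ring
      _ = (c + Φ) * (L : ℝ) ^ 2 + μ * (N - n * (L : ℝ) ^ 2) := by rw [hdiv]
  rw [hexp]
  exact hkey

/-- **Transport to the route row.** If the lifted finite-torus inequality holds for all large `L` at the
canonical point (`t = 1`, `U = 8`, `n = 7/8`), then `M3EnergyLowerRow 0 lo` for every rational
`lo ≤ c + Φ`; with `c = −0.8295699476` (#529) the crux `LowerEdge_ge_m4o5` needs `Φ ≥ 0.0295699476`. -/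
theorem m3LowerRow_of_strip_increment {c Φ μ : ℝ} {lo : ℚ} (hlo : ((lo : ℚ) : ℝ) ≤ c + Φ)
    (h : ∀ᶠ L : ℕ in atTop, (c + Φ) + μ * ((rectN (7 / 8) L : ℝ) / (L : ℝ) ^ 2 - 7 / 8) ≤
      groundEnergyAt (fermionTorusGraph 2 L) 1 8 (rectN (7 / 8) L) / (L : ℝ) ^ 2) :
    M3EnergyLowerRow 0 lo := by
  have h8 : (0 : ℝ) ≤ 8 := by norm_num
  have hlim := energyDensity2D_ge_of_eventually_ge_torus 1 h8 (n := 7 / 8) (by norm_num) (by norm_num) h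
  unfold M3EnergyLowerRow
  rw [energyDensityTT'_zero]
  exact hlo.trans hlim

/-- The crux follows from a lifted-constant row at any `Φ` with `c + Φ ≥ −4/5` (value arithmetic only). -/
theorem lowerEdge_target_of_row {lo : ℚ} (hlo : (-4 / 5 : ℚ) ≤ lo) (hrow : M3EnergyLowerRow 0 lo) :
    ∃ lo' : ℚ, -4 / 5 ≤ lo' ∧ M3EnergyLowerRow 0 lo' := ⟨lo, hlo, hrow⟩

end Summit.Ventures.CertifiedManyBodySolver.Cruxes.LowerEdge_ge_m4o5.CertificateFrustrationLadder
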